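import Summits.ResolutionOfSingularities.ResolutionOfSingularities.Theorems.RadicialJungCleanModelsNSAbsorption
import Summits.ResolutionOfSingularities.ResolutionOfSingularities.Theorems.RadicialJungCleanModelsNSUnitNormalization
import Summits.ResolutionOfSingularities.ResolutionOfSingularities.Theorems.RadicialJungCleanModelsNSCoordinateLift
import Summits.ResolutionOfSingularities.ResolutionOfSingularities.Theorems.RadicialJungCleanModelsNSCoordinateLiftCompanion
import Summits.ResolutionOfSingularities.ResolutionOfSingularities.Theorems.RadicialJungCleanModelsNSBlowupPrescribedRsp
import Summits.ResolutionOfSingularities.ResolutionOfSingularities.Theorems.RadicialJungCleanModelsNSRescale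
import Summits.ResolutionOfSingularities.ResolutionOfSingularities.Theorems.RadicialJungCleanModelsNSLiftStep
import Summits.ResolutionOfSingularities.ResolutionOfSingularities.Theorems.RadicialJungCleanModelsNSChainTransport
import Summits.ResolutionOfSingularities.ResolutionOfSingularities.Theorems.RadicialJungCleanModelsNSResidueRegularize
import Summits.ResolutionOfSingularities.ResolutionOfSingularities.Theorems.RadicialJungCleanModelsNSPreChain
import Summits.ResolutionOfSingularities.ResolutionOfSingularities.Theorems.RadicialJungCleanModelsWeakEmbeddedLUAlongCoarsening
import Summits.ResolutionOfSingularities.ResolutionOfSingularities.Theorems.RadicialJungCleanModelsCor217Transport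
import Literature.AlgebraicGeometry.Resolution.EmbeddedResolutionExcellentSurfaces
import HarnessLib

/-!
# SPEC (sorried targets, crux workfile — NOT a Theorems file): the residue-side DRIVER and the ASSEMBLY of «hMono_4 ⟸ hMono_4 at RANK ONE»

Crux `CleanModels` (stmt-ResolutionOfSingularities-15917), line `Sketch` rev 35, stub 7 `stub_cleanModelsDimGEFour`.  Seat `decomp-res-hand-2` g5;
memo `Cruxes/CleanModels/Lines/Sketch-memo-hand2-g5-stubs-5-7.md` §3.  Supersedes g4's `Sketch_hand2_g4_NS32_spec.lean` (whose one target
`spec_absorption` is now ✓ `absorption_step`, p801199).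

After g5 the whole MODEL-SIDE ALGEBRA of the repaired Novacoski–Spivakovsky 2012 §3.2 combination is in the kernel:
✓ `weakEmbeddedLU_along_properCoarsening_dimLEFour` (step (i)) · ✓ `exists_rsp_in_model_of_monomial` (rescaling, coefficients in the model) ·
✓ `cor217_transport` / ✓ `weakEmbeddedLU_residueSide_dimLEFour` (plain regularisation of the residue ring, step (ii) with `W = ∅`) ·
✓ `exists_mul_centre_subset_span` + ✓ `blowupAlong_rsp_of_centre` (§3.1 step for the PRESCRIBED r.s.p.: `𝔭' = (Y/a)` in the model, regular at
the centre) · ✓ `centre_locAtCentre_adjoin_div_le_map` (COORDINATE LIFT: `𝔭` stays EXTENDED when `z/z₀` is adjoined for a quasi-regular residue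
family) · ✓ `locGen_of_centre_le_map` · ✓ `locGen_sup_adjoin_div` (adjoin `Y/z₀`) · ✓ `exists_model_centre_eq_span_of_local` (back to a
model-level `𝔭 = (Y)`) · ✓ `absorption_step` (last blowing up along `(x^m, Y)`; unit × monomial).

What is NOT in the kernel (typed below with `sorry`):
* `ELU3Coord` (definition, residue-side currency = subrings of the residue FIELD `F` with a valuation ring `Ō`): embedded local uniformization of a
  finite set in an excellent REGULAR local ring of dimension `≤ 3` along a zero-dimensional valuation by a finite chain of COORDINATE local blowing
  ups (centres = part of a regular system of parameters, `ν̄`-minimal chart), ending with the set AND the accumulated exceptional parameters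
  unit × monomial.  A printed theorem (Cossart–Jannsen–Saito 2020 Thm. 1.4 / Cor. 1.5 localised along the valuation; for residue rings of
  dimension `≤ 2`, Zariski–Abhyankar).
* `spec_ELU3Coord_of_cjs2020` — F-32 (the tree's `CossartJannsenSaito2020Embedded`, whose `IsEmbeddedTransform` IS the blow-up SEQUENCE, with
  ✓ `isRsopGeneratedAt_of_isRegular_subscheme` for «regular centre ⇒ rsop-generated at each point») ⟹ `ELU3Coord`: the scheme-to-local EXTRACTION
  along `ν̄` (each blow-up either misses the centre of `ν̄` — local ring unchanged — or is the coordinate local blowing up at it; at the end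
  `π⁻¹(V(∏ W))` snc ⇒ every element vanishing only on it is a unit × monomial in the stalk).  Size L.
  (The model `B` is NOT asked to have fraction field `F`: in the assembly `F = κ(O₁)` and `B = ρ(A)` is the ring of residues of the model, whose
  fraction field `κ(𝔭)` may be smaller; `Ō ∩ Frac B` is the relevant valuation ring.  Since g5 the model-side INDUCTION over such a chain is in the
  kernel: ✓ `liftStep_of_isRsopPart` (one step) and ✓ `chainTransport_of_isRsopPart` (whole chain, `Theorems/…NSChainTransport.lean`).)
* (S6) interface, NOT yet typed as a theorem: from the output of ✓ `chainTransport_of_isRsopPart` (model `A_n`, `𝔭 = (Y/D)`, residue ring `Sq n`)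
  and the final clause of `ELU3Coord` (a full r.s.p. `x̄` of `Sq n` in which the residues of the coefficients `c_z a^{|μ|} D^{|μ|}` are unit ×
  monomial) produce the hypotheses of ✓ `absorption_step`: lift `x̄_j = ρ(n_j)/ρ(e_j)` to `x_j := n_j ∈ A_n`; `hregQ`/`hdimt` through
  `(A_n)_𝔮/𝔭 ≃ θ.range = ρ(locAtCentre A_n O)` (✓ `nonempty_quotCentre_ringEquiv_range`, ✓ `range_centreResidueLift_eq_range_residue_locAtCentre`)
  `= Sq n`; `hx𝔪` by clearing the denominators of `ρ(c) = Σ r̄_l x̄_l`.  CAVEAT for the next hand: `absorption_step` asks the unit `u_z` IN THE MODEL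
  (`u : K → A.toSubring`); the residue data only give `u_z = p/(q ∏ e_i^{δ_i}) ∈ locAtCentre A O` — land the 10-line generalisation of
  ✓ `absorption_step` with `u z ∈ locAtCentre A'.toSubring O`, `ν(u z) = 0` (its proof uses `u z` only through `ν(u z) = 0` and `π/x^m ∈ locAtCentre A' O`),
  or pre-adjoin the inverses `1/q`, `1/e_i` (ν-units) and re-normalise with ✓ `exists_model_centre_eq_span_of_local`.
* REV 4 (03:35Z): THE ASSEMBLY IS WRITTEN AND ELABORATES — `Theorems/RadicialJungCleanModelsNSRankOneReduction.lean`,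
  `localMonomialization_four_of_rankOne_of_residueChains` (p807931): `hMono_4` at every zero-dimensional valuation from `hMono_4` at RANK ONE +
  F-02 + F-32 + `ResidueChains` (inlined as the hypothesis `hChains`).  So the ONLY remaining target of this spec is the residue-side driver
  `CossartJannsenSaito2020Embedded → ResidueChains O O₁ hO` (for `O` zero-dimensional over `k`, `trdeg_k K ≤ 4`, `O < O₁ < K`); the sorried
  `spec_localMonomialization_four_of_rankOne` below is kept only as the record of the original target shape (it follows from the landed theorem
  once `hELU` is traded for `ResidueChains`).
* REV 3: the CONSUMABLE form `ResidueChains O O₁ hO` of the driver is typed below (keyed to ✓ `chainTransport_of_isRsopPart` and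
  `absorb_of_residue_monomial`); with it the assembly is pure plumbing: `preChain_normalForm` → `ResidueChains` on `A₅` with `W := {c_z}` →
  `chainTransport_of_isRsopPart` → regroup `z = (c_z D^{|γ|}) · (Y/D)^γ`, residues of `c_z D^{|γ|}` unit × monomial (products) → `hregQ`/`hdimt` of
  the last model through `A_𝔮/𝔭 ≃ θ.range = ρ(locAtCentre A O) = Sq n` → `absorb_of_residue_monomial`.
* `spec_localMonomialization_four_of_rankOne` — THE ASSEMBLY (size M given the items above; model side = ✓ `preChain_normalForm` (S1–S4, file
  `…NSPreChain.lean`) + `hELU` + ✓ `chainTransport_of_isRsopPart` (S5) + (S6) + ✓ `absorption_step`): for `O` zero-dimensional COMPOSITE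
  (`O < O₁ < K`) run step (i), rescale, plain-regularise the residue ring, §3.1-step, then transport the `ELU3Coord` chain of the residue ring
  `L/𝔭_L ≅ θ.range ⊆ κ(O₁)` (✓ `nonempty_quotCentre_ringEquiv_range`) through the coordinate lift step by step — the quasi-regularity hypothesis of
  ✓ `centre_locAtCentre_adjoin_div_le_map` coming from «part of an r.s.p. of a regular local ring is a regular, hence quasi-regular, sequence»
  (tree ✓ `isQuasiRegular_of_isWeaklyRegular` + Cohen–Macaulay files) transported along that ring isomorphism — and finish with ✓ `absorption_step`
  (`m_l ≥` all residue exponents).  Output: `hMono_4` at EVERY zero-dimensional `O` from `hMono_4` at RANK-ONE `O` + F-02 + F-32.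
-/

noncomputable section

set_option linter.dupNamespace false

open IsLocalRing AlgebraicGeometry CategoryTheory
open Literature.AlgebraicGeometry.Resolution Literature.AlgebraicGeometry.Motives

namespace Summit.ResolutionOfSingularities.ResolutionOfSingularities.Theorems.RadicialJung.CleanModels.NS32AssemblySpec

/-- **`ELU3Coord F Ō S W`** (SPEC definition, residue-side currency): for a field `F`, a valuation ring `Ō` of `F`, a local subring `S ⊆ Ō`
dominated by `Ō` (`locAtCentre S Ō = S`) and a finite `W ⊆ S ∖ {0}`: there is a finite chain `S = S 0, S 1, …, S n ⊆ Ō`, each `S (i+1)` the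
`Ō`-local ring of `S i [z_l / z₀ : l]` for a family `(z₀, z_l)` that is PART OF A REGULAR SYSTEM OF PARAMETERS of the regular local ring `S i`
with `z₀` `ν̄`-minimal, such that `S n` is regular with a regular system of parameters (a family `x` of `dim` elements generating the
centre of `Ō`) in which every `w ∈ W` and every `z₀` used on the way is a unit times a monomial. [cite: CossartJannsenSaito2020, Thm. 1.4 and Cor. 1.5] -/
def ELU3Coord (F : Type) [Field F] (Ō : ValuationSubring F) (S : Subring F) (W : Finset F) : Prop :=
  ∃ (n : ℕ) (Sq : ℕ → Subring F) (s : ℕ → ℕ) (z₀ : ℕ → F) (z : (i : ℕ) → Fin (s i) → F),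
    Sq 0 = S ∧
    (∀ i ≤ n, Sq i ≤ Ō.toSubring ∧ locAtCentre (Sq i) Ō = Sq i ∧ IsRegularLocalRing (Sq i)) ∧
    (∀ i < n,
      z₀ i ∈ Sq i ∧ (∀ l, z i l ∈ Sq i) ∧ Ō.valuation (z₀ i) < 1 ∧ (∀ l, Ō.valuation (z i l) ≤ Ō.valuation (z₀ i)) ∧
      -- `(z₀, z)` is part of a regular system of parameters of `Sq i`
      (∃ (t : ℕ) (x : Fin t → Sq i) (e : Fin (s i + 1) ↪ Fin t),
        (∀ f : Sq i, Ō.valuation (f : F) < 1 ↔ f ∈ Ideal.span (Set.range x)) ∧ ringKrullDim (Sq i) = (t : WithBot ℕ∞) ∧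
        ((x (e 0) : F) = z₀ i) ∧ (∀ l : Fin (s i), (x (e l.succ) : F) = z i l)) ∧
      Sq (i + 1) = locAtCentre (Subring.closure ((Sq i : Set F) ∪ Set.range fun l => z i l / z₀ i)) Ō) ∧
    ∃ (t : ℕ) (x : Fin t → Sq n), (∀ f : Sq n, Ō.valuation (f : F) < 1 ↔ f ∈ Ideal.span (Set.range x)) ∧
      ringKrullDim (Sq n) = (t : WithBot ℕ∞) ∧
      ∀ w : F, (w ∈ W ∨ ∃ i < n, w = z₀ i) → ∃ (u : Sq n) (μ : Fin t → ℕ), IsUnit u ∧ w = (u : F) * ∏ j, ((x j : Sq n) : F) ^ (μ j)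

/-- **`ResidueChains O O₁ hO`** (SPEC definition, rev 3 — THE CONSUMABLE FORM of the residue-side driver, keyed to the landed model-side theorems):
for every finitely generated model `A ⊆ O` with regular residue ring `A_𝔮/𝔭` and every finite set `W ⊆ A` of `ν₁`-units, a residue-side chain in
EXACTLY the format consumed by ✓ `chainTransport_of_isRsopPart` (starting at `ρ(locAtCentre A O)`), whose last ring `Sq n` is regular of
dimension `t` with elements `x̄₁..x̄_t` (positive `ν̄`-value, non-zero, generating the centre of `ν̄`) in which the residues of the `w ∈ W` AND the
`z̄₀⁽ⁱ⁾` are `ν̄`-unit × monomial — EXACTLY the format consumed by `absorb_of_residue_monomial` (`…NSPostChain.lean`) after multiplying out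
`c_z D^{|μ|}`.  The residue-side driver (R1b) should prove `CossartJannsenSaito2020Embedded → ResidueChains O O₁ hO` for `O` zero-dimensional over `k`
with `trdeg_k K ≤ 4` and `O < O₁ < K`. [cite: CossartJannsenSaito2020, Thm. 1.4 and Cor. 1.5] -/
def ResidueChains {k K : Type} [Field k] [Field K] [Algebra k K] (O O₁ : ValuationSubring K) (hO : O ≤ O₁) : Prop :=
  ∀ (A : Subalgebra k K) (hA : A.toSubring ≤ O.toSubring), A.FG → IsFractionRing A K →
    IsRegularLocalRing
      (Localization.AtPrime ((maximalIdeal O).comap (Subring.inclusion hA)) ⧸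
        ((maximalIdeal O₁).comap (Subring.inclusion (hA.trans hO))).map
          (algebraMap A.toSubring (Localization.AtPrime ((maximalIdeal O).comap (Subring.inclusion hA))))) →
    ∀ (W : Finset K), (∀ w ∈ W, w ∈ A ∧ O₁.valuation w = 1) →
    ∃ (n : ℕ) (Sq : ℕ → Subring (ResidueField O₁)) (hSloc : ∀ i, IsLocalRing (Sq i)) (s : ℕ → ℕ)
      (zb : (i : ℕ) → Fin (s i + 1) → ResidueField O₁) (hzbS : ∀ i j, zb i j ∈ Sq i),
      ((residue O₁).comp (Subring.inclusion ((locAtCentre_le hA).trans hO))).range = Sq 0 ∧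
      (∀ i, i < n → (haveI := hSloc i; IsRsopPart (fun j : Fin (s i + 1) => (⟨zb i j, hzbS i j⟩ : Sq i)))) ∧
      (∀ i, i < n → (residueValuationSubring O O₁ hO).valuation (zb i 0) < 1) ∧
      (∀ i, i < n → ∀ l : Fin (s i),
        (residueValuationSubring O O₁ hO).valuation (zb i l.succ) ≤ (residueValuationSubring O O₁ hO).valuation (zb i 0)) ∧
      (∀ i, i < n → Sq (i + 1) =
        locAtCentre (Subring.closure ((Sq i : Set (ResidueField O₁)) ∪ Set.range fun l : Fin (s i) => zb i l.succ / zb i 0))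
          (residueValuationSubring O O₁ hO)) ∧
      ∃ (t : ℕ) (xb : Fin t → ResidueField O₁), (∀ i, xb i ∈ Sq n) ∧
        (∀ i, (residueValuationSubring O O₁ hO).valuation (xb i) < 1) ∧ (∀ i, xb i ≠ 0) ∧
        (∀ f ∈ Sq n, (residueValuationSubring O O₁ hO).valuation f < 1 →
          ∃ r : Fin t → ResidueField O₁, (∀ i, r i ∈ Sq n) ∧ f = ∑ i, r i * xb i) ∧
        IsRegularLocalRing (Sq n) ∧ ringKrullDim (Sq n) = (t : WithBot ℕ∞) ∧
        (∀ w : ResidueField O₁, ((∃ w' ∈ W, ∃ hw : w' ∈ O₁, residue O₁ ⟨w', hw⟩ = w) ∨ ∃ i < n, w = zb i 0) →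
          ∃ (ub : ResidueField O₁) (δ : Fin t → ℕ), ub ∈ Sq n ∧
            (residueValuationSubring O O₁ hO).valuation ub = 1 ∧ w = ub * ∏ i, xb i ^ δ i)

/-- SPEC (R1b): **F-32 ⟹ `ELU3Coord`** for excellent regular local rings of dimension `≤ 3` that are local rings of finitely generated algebras over
a field at a closed point, along zero-dimensional valuations.  `sorry`: a TARGET. [cite: CossartJannsenSaito2020, Thm. 1.4 and Cor. 1.5] -/
theorem spec_ELU3Coord_of_cjs2020 (hCJS : CossartJannsenSaito2020Embedded.{0})
    (k F : Type) [Field k] [Field F] [Algebra k F] (Ō : ValuationSubring F)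
    (B : Subalgebra k F) (hB : B.toSubring ≤ Ō.toSubring) (hBfg : B.FG)
    (hdim : ringKrullDim B ≤ 3) (hreg : IsRegularLocalRing (locAtCentre B.toSubring Ō))
    (hzd : ∀ (T : Subring F) (hT : T ≤ Ō.toSubring), B.toSubring ≤ T → (subringCentre T Ō hT).IsMaximal)
    (W : Finset F) (hW : ∀ w ∈ W, w ∈ B ∧ w ≠ 0) :
    ELU3Coord F Ō (locAtCentre B.toSubring Ō) W := by
  sorry

/-- SPEC (R5): **THE ASSEMBLY — `hMono_4` at every zero-dimensional valuation from `hMono_4` at RANK-ONE valuations, modulo F-02 + F-32 and the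
residue-side driver `ELU3Coord`** (repaired Novacoski–Spivakovsky 2012 Thm. 1.2 in dimension 4).  `sorry`: a TARGET; the plan is in the module
docstring and in memo §3. [cite: NovacoskiSpivakovsky2014, Thm. 1.2 and §3.2] -/
theorem spec_localMonomialization_four_of_rankOne (hCP : CossartPiltant2019.{0})
    (hEmb : ∀ (Z : Scheme.{0}) [IsIntegral Z] [IsNoetherian Z], Scheme.IsRegular Z →
      Scheme.IsExcellent Z → ∀ (X : Set Z), IsClosed X → X ≠ Set.univ → topologicalKrullDim X ≤ 2 →
        ∃ (Z' : Scheme.{0}) (π : Z' ⟶ Z), IsProper π ∧ Function.Surjective π.base ∧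
          (∃ U : Z.Opens, (U : Set Z) = Xᶜ ∧ IsIso (π ∣_ U)) ∧
          IsStrictNormalCrossingsDivisor Z' (π.base ⁻¹' X))
    (hELU : ∀ (k F : Type) [Field k] [Field F] [Algebra k F] (Ō : ValuationSubring F)
      (B : Subalgebra k F) (hB : B.toSubring ≤ Ō.toSubring), B.FG →
      ringKrullDim B ≤ 3 → IsRegularLocalRing (locAtCentre B.toSubring Ō) →
      (∀ (T : Subring F) (hT : T ≤ Ō.toSubring), B.toSubring ≤ T → (subringCentre T Ō hT).IsMaximal) →
      ∀ W : Finset F, (∀ w ∈ W, w ∈ B ∧ w ≠ 0) → ELU3Coord F Ō (locAtCentre B.toSubring Ō) W)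
    (hRankOne : ∀ (k : Type) [Field k] (K : Type) [Field K] [Algebra k K]
      (O : ValuationSubring K) (A : Subalgebra k K), A.toSubring ≤ O.toSubring → A.FG → IsFractionRing A K →
      ringKrullDim A ≤ (4 : WithBot ℕ∞) → IsRegularLocalRing (locAtCentre A.toSubring O) →
      ringKrullDim (locAtCentre A.toSubring O) = (4 : WithBot ℕ∞) →
      (∀ (T : Subring K) (hT : T ≤ O.toSubring), A.toSubring ≤ T → (subringCentre T O hT).IsMaximal) →
      ¬ (∃ O₁ : ValuationSubring K, O ≤ O₁ ∧ O₁ ≠ O ∧ O₁ ≠ ⊤) →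
      ∀ Z : Finset K, (∀ z ∈ Z, z ∈ A) →
      ∃ (A' : Subalgebra k K), A'.toSubring ≤ O.toSubring ∧ A ≤ A' ∧ A'.FG ∧
      ∃ (_ : IsRegularLocalRing (locAtCentre A'.toSubring O)) (e : ℕ) (a : Fin e → ↥(locAtCentre A'.toSubring O)),
        Ideal.span (Set.range a) = IsLocalRing.maximalIdeal ↥(locAtCentre A'.toSubring O) ∧
        ringKrullDim ↥(locAtCentre A'.toSubring O) = (e : WithBot ℕ∞) ∧
        ∀ z ∈ Z, z ≠ 0 → ∃ (v : ↥(locAtCentre A'.toSubring O)) (μ : Fin e → ℕ), IsUnit v ∧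
          z = (v : K) * ∏ i, ((a i : ↥(locAtCentre A'.toSubring O)) : K) ^ (μ i)) :
    ∀ (k : Type) [Field k] (K : Type) [Field K] [Algebra k K]
      (O : ValuationSubring K) (A : Subalgebra k K), A.toSubring ≤ O.toSubring → A.FG → IsFractionRing A K →
      ringKrullDim A ≤ (4 : WithBot ℕ∞) → IsRegularLocalRing (locAtCentre A.toSubring O) →
      ringKrullDim (locAtCentre A.toSubring O) = (4 : WithBot ℕ∞) →
      (∀ (T : Subring K) (hT : T ≤ O.toSubring), A.toSubring ≤ T → (subringCentre T O hT).IsMaximal) →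
      ∀ Z : Finset K, (∀ z ∈ Z, z ∈ A) →
      ∃ (A' : Subalgebra k K), A'.toSubring ≤ O.toSubring ∧ A ≤ A' ∧ A'.FG ∧
      ∃ (_ : IsRegularLocalRing (locAtCentre A'.toSubring O)) (e : ℕ) (a : Fin e → ↥(locAtCentre A'.toSubring O)),
        Ideal.span (Set.range a) = IsLocalRing.maximalIdeal ↥(locAtCentre A'.toSubring O) ∧
        ringKrullDim ↥(locAtCentre A'.toSubring O) = (e : WithBot ℕ∞) ∧
        ∀ z ∈ Z, z ≠ 0 → ∃ (v : ↥(locAtCentre A'.toSubring O)) (μ : Fin e → ℕ), IsUnit v ∧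
          z = (v : K) * ∏ i, ((a i : ↥(locAtCentre A'.toSubring O)) : K) ^ (μ i) := by
  /- PLAN (memo §3): `by_cases` on the rank-one condition; in the composite case obtain `O < O₁ < ⊤` and run
     (S1) ✓ `weakEmbeddedLU_along_properCoarsening_dimLEFour hCP hEmb` ⟶ `A₂`, gens `a` of `𝔪_{R₁}`, `z = v_z a^μ`;
     (S2) ✓ `exists_rsp_in_model_of_monomial` ⟶ `A₃`, `y ⊆ A₃ ∩ 𝔭`, `c_z ∈ A₃`, `z = c_z y^μ`;
     (S3) ✓ `cor217_transport` with `P :=` «regular» fed by ✓ `weakEmbeddedLU_residueSide_dimLEFour … (W := ∅)` ⟶ `A₄`, residue ring regular,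
          `R₁` unchanged (so `(y) R₁ = 𝔪_{R₁}` persists);
     (S4) ✓ `exists_mul_centre_subset_span` + ✓ `blowupAlong_rsp_of_centre` ⟶ `A₅` regular at `𝔮`, `𝔭₅ = (Y') · A₅` with `Y' = y/a`, residues
          unchanged, `z = (c_z a^{|μ|}) Y'^μ`;
     (S5) `hELU` on the residue ring `S₀ = ρ(locAtCentre A₅ O) = locAtCentre (ρ A₅) Ō` (✓ `range_residue_locAtCentre`) with `W̄ :=` residues of
          `{c_z, a}`; then ✓ `chainTransport_of_isRsopPart` (induction on the chain via ✓ `liftStep_of_isRsopPart`) keeps: model f.g. in `O`,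
          `locAtCentre · O₁ = R₁`, `𝔭 = (Y/D)` model-level with `#(Y/D) = r`, residue ring `= Sq n`, and `z = (c_z a^{|μ|} D^{|μ|}) (Y'/D)^μ` with the
          residue of `D` = `∏ z̄₀⁽ⁱ⁾` up to a unit of `Sq n`;
     (S6) at the end the residues of `c_z⁽ⁿ⁾` are units × monomials in the final residue r.s.p. `x̄` (the `W̄ ∪ {z̄₀⁽ⁱ⁾}` clause of `ELU3Coord`);
          lift `x̄` to `x ⊆ A`, read off `δ_z`, `u_z`, take `m_l := max_z δ_{z,l}`, and apply ✓ `absorption_step`. -/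
  sorry

end Summit.ResolutionOfSingularities.ResolutionOfSingularities.Theorems.RadicialJung.CleanModels.NS32AssemblySpec

end
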